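import Summits.QuantumFields.YangMills.Theorems.BalabanUVNodesPortS1ZkRecord
import Summits.QuantumFields.YangMills.Theorems.BalabanUVNodesK0RecordFormatNamesFluctE

/-!
# NODE O port PT-A — THE Z-BRIDGE AT THE RECORD's NAMES (ρZ-2): DEF-1's CANONICAL (1.4) Gaussian `recordZkΔ1Can` ∕ `recordZkkCan` (ed.15d ✓p805617, coarea ∕ Gram form over the
# arbitrary kernel basis `recordCop`) EQUALS the GRAPH-COORDINATE twin `recordZkLoc` ∕ `recordZkkLoc` (ed.15e, print's elimination of the `b₀`-variables, p.268 «the remaining variables B …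
# B′ = CB») UNDER the letter `RecordB0BlockInvertible` (print's «h is uniquely defined», p.267), a dimension match `Fin (finrank ker LQ̃) ≃ NonB0Idx`, and positivity of the preconditioned
# matrix `recordPrecLoc` ∕ `recordPreckLoc` (NODE O's (P), displayed)

Cell `ym-nodeO-ideate`, porter `ymgap-nodeO-port-PTA-1` (gen 4); `--supports stmt-QuantumFields-27930` (helper; object-free bridge = `…PortS1ZkCoarea`, ✓p803582∕✓p803640).  [I] = [Balaban1987RG1].
WHY IT MATTERS.  The LZ half of 27930's residue runs [16] (63)'s walk localisation on the `T` of `B10LogDet63.matrix63`, indexed by print's GEOMETRIC graph coordinates `C_loc = [−A₁⁻¹A₂; 1]`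
(`recordCopLoc`∕`recordPrecLoc`∕`recordZkLoc`); the SPLIT names `Z^{(k)}` by the canonical (1.4) normalisation (`recordZkΔ1Can`∕`recordZkkCan`).  This file proves they are ONE number.
§1 (generic) `Z14` under reindexing (rows: `Z14_submatrix_equiv`, unconditional; columns: `Z14_submatrix_cols`, closed Gaussian form), Gram and `Q̃Q̃ᵀ` under reindexing.  §2 (generic) graph
factorisation `[A₁ A₂]·C′ = 0 ⟹ C′ = [−X; 1]·(lower block)` (`eq_graphC_mul_toRows₂`), injective `C′` ⟹ lower block invertible, ★ `zGram_eq_zLoc` (Gram-form twin of `zCan_eq_zLoc`, no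
orthonormal carrier).  §3 (record) `blkToFluct` bijective (`centralBond_injective`, standing range), `recordLQtBlk = recordLQtMat ∘ blkToFluct`, `recordLQtMat · recordCop = 0` (linearity of
`su2Coord`), `recordCop` injective; ★★ `recordZkΔ1Can_eq_recordZkLoc`, ★★ `recordZkkCan_eq_recordZkkLoc` (+ logs).  The dimension match `σ : Fin (finrank ker LQ̃) ≃ NonB0Idx` is DISPLAYED
(= «`LQ̃` of record is 𝔰𝔲(2)-valued», true for the derivative of the log of an `SU(2)`-valued average, not proved here — SAID).

HONEST FRAMING.  Linear algebra at the record's names; NOTHING of Bałaban asserted∕ported∕discharged (not the letter, positivity, or su(2)-valuedness of `LQ̃`); 27930 OPEN; K0⁷∕K-Ax OPEN;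
NODE O 0∕1; COUNT 8∕28 · K 1∕4 UNMOVED; finite `𝕋⁴_{L^K}` at fixed ε — NOT continuum ∕ OS ∕ Clay; **the Yang–Mills mass gap is NOT proved by any of this.**  No `sorry`∕`def`∕`instance`.
-/

noncomputable section

open scoped BigOperators

namespace Summit.QuantumFields.YangMills.Theorems.BalabanUVNodesPortS1

open Summit.QuantumFields.YangMills.Theorems.K0RecordFormatNames
open Literature.MathematicalPhysics.QuantumFieldTheory.Balaban1983to89
open Literature.MathematicalPhysics.QuantumFieldTheory.Balaban1983to89.Node00
open Literature.MathematicalPhysics.QuantumFieldTheory.Balaban1983to89.T4Continuum (T4Family)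
open _root_.Matrix

/-! ## §1  `Z14`, the Gram matrix and `Q̃Q̃ᵀ` under reindexing -/

section Generic

variable {ι ι' ρ ρ' m : Type*} [Fintype ι] [Fintype ι'] [Fintype ρ] [Fintype ρ'] [Fintype m]

/-- `Z14` is unchanged when the ROW index (the fluctuation coordinates) is relabelled along an equivalence: `Z14 (S∘(e,e)) (N∘(e,id)) = Z14 S N` (the integrand is the same function of `z`).
[cite: Balaban1987RG1, (1.4) p.260 (bookkeeping)] -/
theorem Z14_submatrix_equiv (S : Matrix ι ι ℝ) (N : Matrix ι ρ ℝ) (e : ι' ≃ ι) :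
    B12Eq15QuadraticForm.Z14 (S.submatrix e e) (N.submatrix e id) = B12Eq15QuadraticForm.Z14 S N := by
  unfold B12Eq15QuadraticForm.Z14
  congr 1
  funext z
  have h1 : N.submatrix e id *ᵥ z = (N *ᵥ z) ∘ e := by
    funext i
    rfl
  have h2 : S.submatrix e e *ᵥ ((N *ᵥ z) ∘ e) = (S *ᵥ (N *ᵥ z)) ∘ e := by
    rw [Matrix.submatrix_mulVec_equiv S ((N *ᵥ z) ∘ ⇑e) e e]
    congr 2
    funext i
    simp
  rw [h1, h2, comp_equiv_dotProduct_comp_equiv]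

omit [Fintype ρ] in
/-- The Gram matrix is unchanged under a row relabelling: `(C∘(e,id))ᵀ (C∘(e,id)) = CᵀC`. [cite: Balaban1987RG1, (1.4) p.260 (bookkeeping)] -/
theorem gram_submatrix_equiv (C : Matrix ι ρ ℝ) (e : ι' ≃ ι) : (C.submatrix e id)ᵀ * C.submatrix e id = Cᵀ * C := by
  rw [Matrix.transpose_submatrix, Matrix.submatrix_mul_equiv, Matrix.submatrix_id_id]

omit [Fintype m] in
/-- `Q̃Q̃ᵀ` is unchanged under a column relabelling: `(M∘(id,e)) (M∘(id,e))ᵀ = M Mᵀ`. [cite: Balaban1987RG1, (1.4) p.260 (bookkeeping)] -/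
theorem submatrix_mul_transpose_equiv (M : Matrix m ι ℝ) (e : ι' ≃ ι) : M.submatrix id e * (M.submatrix id e)ᵀ = M * Mᵀ := by
  rw [Matrix.transpose_submatrix, Matrix.submatrix_mul_equiv, Matrix.submatrix_id_id]

omit [Fintype ρ] [Fintype ρ'] in
/-- The Gram matrix under a COLUMN relabelling is the relabelled Gram matrix: `(C∘(id,σ))ᵀ (C∘(id,σ)) = (CᵀC)∘(σ,σ)`. [cite: Balaban1987RG1, (1.4) p.260 (bookkeeping)] -/
theorem gram_submatrix_cols (C : Matrix ι ρ ℝ) (σ : ρ' → ρ) : (C.submatrix id σ)ᵀ * C.submatrix id σ = (Cᵀ * C).submatrix σ σ := by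
  rw [Matrix.transpose_submatrix, Matrix.submatrix_mul Cᵀ C σ _root_.id σ Function.bijective_id]

omit [Fintype ρ] [Fintype ρ'] in
/-- `(C∘(id,σ))ᵀ S (C∘(id,σ)) = (CᵀSC)∘(σ,σ)`. [cite: Balaban1987RG1, (1.4) p.260 (bookkeeping)] -/
theorem conj_submatrix_cols (S : Matrix ι ι ℝ) (C : Matrix ι ρ ℝ) (σ : ρ' → ρ) :
    (C.submatrix id σ)ᵀ * S * C.submatrix id σ = (Cᵀ * S * C).submatrix σ σ := by
  rw [Matrix.transpose_submatrix, Matrix.submatrix_mul (Cᵀ * S) C σ _root_.id σ Function.bijective_id,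
    Matrix.submatrix_mul Cᵀ S σ _root_.id _root_.id Function.bijective_id, Matrix.submatrix_id_id]

/-- `Z14` is unchanged when the COLUMN index (the coordinates `z` on the constraint surface) is relabelled along an equivalence (closed Gaussian form; `CᵀSC` positive definite).
[cite: Balaban1987RG1, (1.4) p.260 (bookkeeping)] -/
theorem Z14_submatrix_cols [DecidableEq ρ] [DecidableEq ρ'] (S : Matrix ι ι ℝ) (C : Matrix ι ρ ℝ) (σ : ρ' ≃ ρ) (h : (Cᵀ * S * C).PosDef) :
    B12Eq15QuadraticForm.Z14 S (C.submatrix id σ) = B12Eq15QuadraticForm.Z14 S C := by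
  have h' : ((C.submatrix id σ)ᵀ * S * C.submatrix id σ).PosDef := by
    rw [conj_submatrix_cols]
    exact h.submatrix σ.injective
  rw [B12Eq15QuadraticForm.Z14_eq S _ h', B12Eq15QuadraticForm.Z14_eq S C h, conj_submatrix_cols, Matrix.det_submatrix_equiv_self,
    Fintype.card_congr σ]

/-! ## §2  The graph factorisation of an arbitrary kernel matrix and the Gram-form bridge -/

variable {p q : Type*} [Fintype p] [Fintype q] [DecidableEq m] [DecidableEq p]

omit [Fintype q] in
/-- **Graph factorisation**: if `[A₁ A₂]·C′ = 0` with `A₁` invertible and `A₁X = A₂`, then `C′ = [−X; 1] · (lower block of C′)` — every kernel vector is determined by its non-`b₀` components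
(print's «h is uniquely defined», «B′ = CB»). [cite: Balaban1987RG1, p.267–268] -/
theorem eq_graphC_mul_toRows₂ (A₁ : Matrix m m ℝ) (A₂ X : Matrix m p ℝ) (hA : IsUnit A₁.det) (hX : A₁ * X = A₂) (C' : Matrix (m ⊕ p) q ℝ)
    (h0 : fromCols A₁ A₂ * C' = 0) :
    C' = fromRows (-X) (1 : Matrix p p ℝ) * C'.toRows₂ := by
  have hX' : X = A₁⁻¹ * A₂ := by rw [← hX, ← Matrix.mul_assoc, Matrix.nonsing_inv_mul _ hA, Matrix.one_mul]
  conv_lhs => rw [← fromRows_toRows C']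
  rw [← fromRows_toRows C', fromCols_mul_fromRows] at h0
  have h1 : C'.toRows₁ = -(A₁⁻¹ * A₂) * C'.toRows₂ := by
    have h2 : A₁⁻¹ * (A₁ * C'.toRows₁ + A₂ * C'.toRows₂) = 0 := by rw [h0, Matrix.mul_zero]
    rw [Matrix.mul_add, ← Matrix.mul_assoc, Matrix.nonsing_inv_mul _ hA, Matrix.one_mul, ← Matrix.mul_assoc] at h2
    rw [Matrix.neg_mul]
    exact eq_neg_of_add_eq_zero_left h2
  rw [fromRows_mul, Matrix.one_mul, h1, ← hX']

omit [Fintype q] [Fintype m] [DecidableEq m] in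
/-- If the kernel matrix `C′ : (m ⊕ p) × p` is injective and factors through the graph parametrisation, its lower block is invertible. [cite: Balaban1987RG1, p.268 (bookkeeping)] -/
theorem isUnit_det_toRows₂ (X : Matrix m p ℝ) (C' : Matrix (m ⊕ p) p ℝ) (hC : C' = fromRows (-X) (1 : Matrix p p ℝ) * C'.toRows₂)
    (hinj : Function.Injective C'.mulVec) : IsUnit (C'.toRows₂).det := by
  rw [← Matrix.isUnit_iff_isUnit_det, ← Matrix.mulVec_injective_iff_isUnit]
  intro v w hvw
  apply hinj
  rw [hC, ← Matrix.mulVec_mulVec, ← Matrix.mulVec_mulVec, hvw]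

omit [Fintype q] [DecidableEq m] in
/-- The Gram matrix of the graph parametrisation `[−X; 1]` is positive definite (`= 1 + XᵀX`). [cite: Balaban1987RG1, p.268 (bookkeeping)] -/
theorem posDef_gram_graphC (X : Matrix m p ℝ) : ((fromRows (-X) (1 : Matrix p p ℝ))ᵀ * fromRows (-X) (1 : Matrix p p ℝ)).PosDef := by
  have h : (fromRows (-X) (1 : Matrix p p ℝ))ᵀ * fromRows (-X) (1 : Matrix p p ℝ) = 1 + Xᵀ * X := by
    rw [transpose_fromRows, fromCols_mul_fromRows, transpose_neg, transpose_one, Matrix.neg_mul, Matrix.mul_neg, neg_neg, Matrix.one_mul, add_comm]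
  rw [h]
  refine Matrix.PosDef.one.add_posSemidef ?_
  simpa only [Matrix.conjTranspose_eq_transpose_of_trivial] using Matrix.posSemidef_conjTranspose_mul_self X

omit [Fintype q] in
/-- ★ **COAREA∕GRAM = GRAPH** (the Gram-form twin of `zCan_eq_zLoc`, no orthonormal carrier): for the linear constraint `Q̃ = [A₁ A₂]` (`A₁` invertible, `A₁X = A₂`), ANY injective kernel matrix
`C′ : (m ⊕ p) × p` (`Q̃C′ = 0`) and a quadratic form `S` positive on the graph `C_loc = [−X; 1]`:
`(√det(Q̃Q̃ᵀ))⁻¹ · (√det(C′ᵀC′) · Z14 S C′) = |det A₁|⁻¹ · Z14 S C_loc` — DEF-1's `recordZkCan`-shape equals print's `b₀`-elimination Gaussian. [cite: Balaban1987RG1, (1.4) p.260, p.267–268] -/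
theorem zGram_eq_zLoc (S : Matrix (m ⊕ p) (m ⊕ p) ℝ) (A₁ : Matrix m m ℝ) (A₂ X : Matrix m p ℝ) (hA : IsUnit A₁.det) (hX : A₁ * X = A₂)
    (C' : Matrix (m ⊕ p) p ℝ) (h0 : fromCols A₁ A₂ * C' = 0) (hinj : Function.Injective C'.mulVec)
    (hpos : ((fromRows (-X) (1 : Matrix p p ℝ))ᵀ * S * fromRows (-X) (1 : Matrix p p ℝ)).PosDef) :
    (Real.sqrt (fromCols A₁ A₂ * (fromCols A₁ A₂)ᵀ).det)⁻¹ * (Real.sqrt (C'ᵀ * C').det * B12Eq15QuadraticForm.Z14 S C') =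
      |A₁.det|⁻¹ * B12Eq15QuadraticForm.Z14 S (fromRows (-X) (1 : Matrix p p ℝ)) := by
  have hC : C' = fromRows (-X) (1 : Matrix p p ℝ) * C'.toRows₂ := eq_graphC_mul_toRows₂ A₁ A₂ X hA hX C' h0
  have hY : IsUnit (C'.toRows₂).det := isUnit_det_toRows₂ X C' hC hinj
  have hX' : X = A₁⁻¹ * A₂ := by rw [← hX, ← Matrix.mul_assoc, Matrix.nonsing_inv_mul _ hA, Matrix.one_mul]
  have hbc : Real.sqrt (C'ᵀ * C').det * B12Eq15QuadraticForm.Z14 S C' =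
      Real.sqrt ((fromRows (-X) (1 : Matrix p p ℝ))ᵀ * fromRows (-X) (1 : Matrix p p ℝ)).det * B12Eq15QuadraticForm.Z14 S (fromRows (-X) (1 : Matrix p p ℝ)) := by
    have h := sqrt_gram_mul_Z14_basis_change S (fromRows (-X) (1 : Matrix p p ℝ)) C'.toRows₂ hpos hY
    rwa [← hC] at h
  have hdet : (fromCols A₁ A₂ * (fromCols A₁ A₂)ᵀ).det = A₁.det ^ 2 * ((fromRows (-X) (1 : Matrix p p ℝ))ᵀ * fromRows (-X) (1 : Matrix p p ℝ)).det := by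
    rw [hX']
    exact det_fromCols_mul_transpose_eq A₁ A₂ hA
  have hGpos : 0 < ((fromRows (-X) (1 : Matrix p p ℝ))ᵀ * fromRows (-X) (1 : Matrix p p ℝ)).det := (posDef_gram_graphC X).det_pos
  rw [hbc, hdet, Real.sqrt_mul (sq_nonneg _), Real.sqrt_sq_eq_abs, mul_inv]
  have hsq : Real.sqrt ((fromRows (-X) (1 : Matrix p p ℝ))ᵀ * fromRows (-X) (1 : Matrix p p ℝ)).det ≠ 0 := (Real.sqrt_pos.mpr hGpos).ne'
  have hA0 : |A₁.det| ≠ 0 := abs_ne_zero.mpr hA.ne_zero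
  field_simp

end Generic

/-! ## §3  At the record's names -/

variable (F : T4Family)

/-- `blkToFluct` is injective in the standing range `k + 1 ≤ m + K` (the central bonds `b₀(c)` of distinct coarse bonds are distinct: `BlockAveragingHaarAC.centralBond_injective`;
the two summands have disjoint images). [cite: Balaban1987RG1, p.267–268 (bookkeeping)] -/
theorem blkToFluct_injective (k K : ℕ) (hk : k + 1 ≤ (F.P K).m + (F.P K).K) : Function.Injective (blkToFluct F k K) := by
  rintro (⟨c, j⟩ | ⟨i, hi⟩) (⟨c', j'⟩ | ⟨i', hi'⟩) h
  · simp only [blkToFluct, Sum.elim_inl, Prod.mk.injEq] at h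
    obtain ⟨h1, h2⟩ := h
    have hc : c = c' := BlockAveragingHaarAC.centralBond_injective hk h1
    rw [hc, h2]
  · simp only [blkToFluct, Sum.elim_inl, Sum.elim_inr] at h
    exact absurd ⟨c, by rw [← h]⟩ hi'
  · simp only [blkToFluct, Sum.elim_inl, Sum.elim_inr] at h
    exact absurd ⟨c', by rw [h]⟩ hi
  · simp only [blkToFluct, Sum.elim_inr] at h
    exact congrArg Sum.inr (Subtype.ext h)

/-- `blkToFluct` is surjective (a coordinate is either on a central bond or not). [cite: Balaban1987RG1, p.267–268 (bookkeeping)] -/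
theorem blkToFluct_surjective (k K : ℕ) : Function.Surjective (blkToFluct F k K) := by
  rintro ⟨b, a⟩
  by_cases hb : b ∈ Set.range (recordB0 F k K)
  · obtain ⟨c, hc⟩ := hb
    exact ⟨Sum.inl (c, a), by simp [blkToFluct, hc]⟩
  · exact ⟨Sum.inr ⟨(b, a), hb⟩, rfl⟩

/-- `blkToFluct : CoarseIdx ⊕ NonB0Idx → FluctIdx` is a bijection (standing range). [cite: Balaban1987RG1, p.267–268 (bookkeeping)] -/
theorem blkToFluct_bijective (k K : ℕ) (hk : k + 1 ≤ (F.P K).m + (F.P K).K) : Function.Bijective (blkToFluct F k K) :=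
  ⟨blkToFluct_injective F k K hk, blkToFluct_surjective F k K⟩

/-- `LQ̃ = [A₁ A₂]` IS the coordinate matrix of `LQ̃` relabelled along `blkToFluct`: `recordLQtBlk Vk = recordLQtMat Vk ∘ (id, blkToFluct)`. [cite: Balaban1987RG1, p.267 (bookkeeping)] -/
theorem recordLQtBlk_eq_submatrix (k K : ℕ) (Vk : GaugeField (F.P K) k (SU 2)) :
    recordLQtBlk F k K Vk = (recordLQtMat F k K Vk).submatrix _root_.id (blkToFluct F k K) := by
  ext cj (cj' | i)
  · rfl
  · rfl

/-- `su2Coord` evaluated at a coarse bond is ℝ-linear in the bond-matrix field. [folklore] -/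
theorem su2Coord_eval_linear {X : Type*} (c : X) (j : Fin 3) (D D' : X → MatA 2) (t : ℝ) :
    su2Coord ((D + D') c) j = su2Coord (D c) j + su2Coord (D' c) j ∧ su2Coord ((t • D) c) j = t * su2Coord (D c) j := by
  fin_cases j <;> simp [su2Coord]

/-- The real coordinate matrix of `LQ̃` applied to a vector `x` reads the `su2Coord`-coordinates of `LQ̃ x`: `(recordLQtMat Vk *ᵥ x) (c, j) = su2Coord (LQ̃ x c) j` (linearity).
[cite: Balaban1987RG1, p.267 (bookkeeping)] -/
theorem recordLQtMat_mulVec (k K : ℕ) (Vk : GaugeField (F.P K) k (SU 2)) (x : FluctIdx F k K → ℝ) (cj : CoarseIdx F k K) :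
    (recordLQtMat F k K Vk *ᵥ x) cj = su2Coord (recordLQt F k K Vk x cj.1) cj.2 := by
  classical
  obtain ⟨c, j⟩ := cj
  let φ : (PBond (F.P K) (k + 1) → MatA 2) →ₗ[ℝ] ℝ :=
    { toFun := fun D => su2Coord (D c) j
      map_add' := fun D D' => (su2Coord_eval_linear c j D D' 1).1
      map_smul' := fun t D => (su2Coord_eval_linear c j D D t).2 }
  have hφ : ∀ D, φ D = su2Coord (D c) j := fun D => rfl
  have h := LinearMap.pi_apply_eq_sum_univ (φ.comp (recordLQt F k K Vk).toLinearMap) x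
  simp only [LinearMap.coe_comp, Function.comp_apply, ContinuousLinearMap.coe_coe, hφ, smul_eq_mul] at h
  have hsingle : ∀ i : FluctIdx F k K, (Pi.single i (1 : ℝ) : FluctIdx F k K → ℝ) = fun j' => if i = j' then 1 else 0 := by
    intro i
    funext j'
    by_cases hij : i = j'
    · subst hij; simp
    · rw [if_neg hij, Pi.single_apply, if_neg (Ne.symm hij)]
  change (recordLQtMat F k K Vk *ᵥ x) (c, j) = su2Coord (recordLQt F k K Vk x c) j
  rw [h, Matrix.mulVec, dotProduct]
  refine Finset.sum_congr rfl fun i _ => ?_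
  rw [mul_comm]
  simp only [recordLQtMat, hsingle]

/-- ★ **The columns of `recordCop` lie in the coordinate kernel of `LQ̃`**: `recordLQtMat Vk · recordCop Vk = 0` (each column is a vector of `ker LQ̃`; the matrix reads `su2Coord ∘ LQ̃`).
[cite: Balaban1987RG1, p.268 («B′ = CB … the space of solutions of Q̃B′ = 0»)] -/
theorem recordLQtMat_mul_recordCop (k K : ℕ) (Vk : GaugeField (F.P K) k (SU 2)) :
    recordLQtMat F k K Vk * recordCop F k K Vk = 0 := by
  ext cj j'
  have hcol : (fun i => recordCop F k K Vk i j') = ((Module.finBasis ℝ (fluctKer F k K Vk) j' : fluctKer F k K Vk) : FluctIdx F k K → ℝ) := rfl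
  have hker : recordLQt F k K Vk (fun i => recordCop F k K Vk i j') = 0 := by
    rw [hcol]
    have hmem := (Module.finBasis ℝ (fluctKer F k K Vk) j').2
    simp only [fluctKer, LinearMap.mem_ker] at hmem
    exact hmem
  have h := recordLQtMat_mulVec F k K Vk (fun i => recordCop F k K Vk i j') cj
  rw [hker] at h
  rw [Matrix.mul_apply', Matrix.zero_apply]
  rw [Matrix.mulVec, dotProduct] at h
  rw [dotProduct, h]
  obtain ⟨c, j⟩ := cj
  fin_cases j <;> simp [su2Coord]

/-- **The columns of `recordCop` are linearly independent**: `recordCop Vk` is injective as `z ↦ C z` (they are a basis of `ker LQ̃`). [cite: Balaban1987RG1, p.268 («a linear parametrization»)] -/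
theorem recordCop_mulVec_injective (k K : ℕ) (Vk : GaugeField (F.P K) k (SU 2)) : Function.Injective (recordCop F k K Vk).mulVec := by
  intro v w hvw
  have hli := (Module.finBasis ℝ (fluctKer F k K Vk)).linearIndependent
  have hli' : LinearIndependent ℝ (fun j => ((Module.finBasis ℝ (fluctKer F k K Vk) j : fluctKer F k K Vk) : FluctIdx F k K → ℝ)) :=
    hli.map' (fluctKer F k K Vk).subtype (Submodule.ker_subtype _)
  have hrepr : ∀ u : Fin (Module.finrank ℝ (fluctKer F k K Vk)) → ℝ,
      recordCop F k K Vk *ᵥ u = ∑ j, u j • ((Module.finBasis ℝ (fluctKer F k K Vk) j : fluctKer F k K Vk) : FluctIdx F k K → ℝ) := by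
    intro u
    funext i
    simp only [Matrix.mulVec, dotProduct, recordCop, Finset.sum_apply, Pi.smul_apply, smul_eq_mul]
    exact Finset.sum_congr rfl fun j _ => mul_comm _ _
  have h0 : ∑ j, (v - w) j • ((Module.finBasis ℝ (fluctKer F k K Vk) j : fluctKer F k K Vk) : FluctIdx F k K → ℝ) = 0 := by
    simp only [Pi.sub_apply, sub_smul, Finset.sum_sub_distrib, ← hrepr, hvw, sub_self]
  have := Fintype.linearIndependent_iff.mp hli' (v - w) h0
  funext j
  exact sub_eq_zero.mp (this j)

open Classical in
/-- `A₁ · X = A₂` at the record: `recordLQtB0 Vk · recordXLoc Vk = recordLQtOff Vk` UNDER the letter (nonsingular inverse). [cite: Balaban1987RG1, p.267 («LQ̃h = I»)] -/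
theorem recordLQtB0_mul_recordXLoc (k K : ℕ) (Vk : GaugeField (F.P K) k (SU 2)) (hA : RecordB0BlockInvertible F k K Vk) :
    recordLQtB0 F k K Vk * recordXLoc F k K Vk = recordLQtOff F k K Vk := by
  unfold recordXLoc
  rw [← Matrix.mul_assoc, Matrix.mul_nonsing_inv _ hA, Matrix.one_mul]

open Classical in
/-- ★★ **THE Z-BRIDGE AT THE NAMES (Δ₁∕𝒞 form)**: UNDER the letter `RecordB0BlockInvertible Vk`, a dimension match `σ : Fin (finrank ker LQ̃) ≃ NonB0Idx` (= «LQ̃ is 𝔰𝔲(2)-valued», displayed)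
and positivity of the preconditioned matrix `recordPrecLoc` (NODE O (P), displayed), DEF-1's canonical (1.4) Gaussian EQUALS print's `b₀`-elimination Gaussian:
`recordZkΔ1Can … U Vk 𝒞 hopLin = recordZkLoc … U Vk 𝒞 hopLin`. [cite: Balaban1987RG1, (1.4) p.260, (1.5) p.261, p.267–268] -/
theorem recordZkΔ1Can_eq_recordZkLoc (k K : ℕ) (εbg : ℝ) (U : GaugeField (F.P K) 0 (SU 2)) (Vk : GaugeField (F.P K) k (SU 2))
    (𝒞 : (FineIdx F K → ℝ) →ₗ[ℝ] (FineIdx F K → ℝ) →ₗ[ℝ] ℝ) (hopLin : (PBond (F.P K) (k + 1) → MatA 2) →ₗ[ℝ] (FluctIdx F k K → ℝ))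
    (hk : k + 1 ≤ (F.P K).m + (F.P K).K) (hA : RecordB0BlockInvertible F k K Vk) (σ : Fin (Module.finrank ℝ (fluctKer F k K Vk)) ≃ NonB0Idx F k K)
    (hP : (recordPrecLoc F k K εbg U Vk 𝒞 hopLin).PosDef) :
    recordZkΔ1Can F k K εbg U Vk 𝒞 hopLin = recordZkLoc F k K εbg U Vk 𝒞 hopLin := by
  -- the block relabelling and the reindexed kernel matrix
  set e : CoarseIdx F k K ⊕ NonB0Idx F k K ≃ FluctIdx F k K := Equiv.ofBijective _ (blkToFluct_bijective F k K hk) with he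
  have hecoe : (⇑e : CoarseIdx F k K ⊕ NonB0Idx F k K → FluctIdx F k K) = blkToFluct F k K := rfl
  set S := recordSΔ1 F k K εbg U Vk 𝒞 hopLin with hS
  set Cop := recordCop F k K Vk with hCop
  set C' : Matrix (CoarseIdx F k K ⊕ NonB0Idx F k K) (NonB0Idx F k K) ℝ := Cop.submatrix (⇑e) (⇑σ.symm) with hC'
  have hSblk : recordSBlk F k K εbg U Vk 𝒞 hopLin = S.submatrix (⇑e) (⇑e) := by rw [hecoe]; rfl
  have hMblk : recordLQtBlk F k K Vk = (recordLQtMat F k K Vk).submatrix _root_.id (⇑e) := by rw [hecoe]; exact recordLQtBlk_eq_submatrix F k K Vk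
  -- (i) Q̃_blk · C′ = 0 and C′ injective
  have h0 : recordLQtBlk F k K Vk * C' = 0 := by
    rw [hMblk, hC', Matrix.submatrix_mul_equiv, hCop, recordLQtMat_mul_recordCop]
    rfl
  have hinj : Function.Injective C'.mulVec := by
    intro v w hvw
    rw [hC', Matrix.submatrix_mulVec_equiv, Matrix.submatrix_mulVec_equiv, Equiv.symm_symm] at hvw
    have h1 : Cop *ᵥ (v ∘ ⇑σ) = Cop *ᵥ (w ∘ ⇑σ) := by
      funext i
      have := congrFun hvw (e.symm i)
      simpa using this
    have h2 := recordCop_mulVec_injective F k K Vk h1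
    funext j
    have := congrFun h2 (σ.symm j)
    simpa using this
  -- (ii) the Gram-form bridge on the block side
  have hX := recordLQtB0_mul_recordXLoc F k K Vk hA
  have hbridge := zGram_eq_zLoc (S.submatrix (⇑e) (⇑e)) (recordLQtB0 F k K Vk) (recordLQtOff F k K Vk) (recordXLoc F k K Vk) hA hX C'
    (by rw [← h0]; rfl) hinj (by rw [← hSblk]; exact hP)
  -- (iii) positivity of `C′ᵀ S_blk C′` (for the closed Gaussian forms of the column relabelling)
  have hC'fac := eq_graphC_mul_toRows₂ (recordLQtB0 F k K Vk) (recordLQtOff F k K Vk) (recordXLoc F k K Vk) hA hX C' (by rw [← h0]; rfl)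
  have hY := isUnit_det_toRows₂ (recordXLoc F k K Vk) C' hC'fac hinj
  have hposC' : (C'ᵀ * S.submatrix (⇑e) (⇑e) * C').PosDef := by
    rw [hC'fac]
    exact posDef_conj_basis _ _ _ (by rw [← hSblk]; exact hP) hY
  -- (iv) move the left-hand side to the block index
  have hJac : recordJacQ F k K Vk = Real.sqrt (recordLQtBlk F k K Vk * (recordLQtBlk F k K Vk)ᵀ).det := by
    rw [recordJacQ, hMblk, submatrix_mul_transpose_equiv]
  have hGram : recordGramC F k K Vk = Real.sqrt (C'ᵀ * C').det := by
    rw [recordGramC, hC', ← hCop, show Cop.submatrix (⇑e) (⇑σ.symm) = (Cop.submatrix (⇑e) _root_.id).submatrix _root_.id (⇑σ.symm) from rfl,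
      gram_submatrix_cols, Matrix.det_submatrix_equiv_self, gram_submatrix_equiv]
  have hZ : B12Eq15QuadraticForm.Z14 S Cop = B12Eq15QuadraticForm.Z14 (S.submatrix (⇑e) (⇑e)) C' := by
    rw [← Z14_submatrix_equiv S Cop e]
    have hCb : Cop.submatrix (⇑e) _root_.id = C'.submatrix _root_.id (⇑σ) := by
      rw [hC']
      ext i j
      simp
    rw [hCb, Z14_submatrix_cols _ _ σ hposC']
  -- (v) assemble
  rw [recordZkΔ1Can, recordZkLoc, ← hS, ← hCop, hJac, hGram, hZ, mul_assoc, recordLQtBlk, hbridge, hSblk]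
  rfl

open Classical in
/-- `log` form of the Z-bridge (Δ₁∕𝒞 form): `recordLogZkΔ1Can = recordLogZkLoc` under the same hypotheses. [cite: Balaban1987RG1, (1.3)–(1.4) p.260, (2.12) p.267] -/
theorem recordLogZkΔ1Can_eq_recordLogZkLoc (k K : ℕ) (εbg : ℝ) (U : GaugeField (F.P K) 0 (SU 2)) (Vk : GaugeField (F.P K) k (SU 2))
    (𝒞 : (FineIdx F K → ℝ) →ₗ[ℝ] (FineIdx F K → ℝ) →ₗ[ℝ] ℝ) (hopLin : (PBond (F.P K) (k + 1) → MatA 2) →ₗ[ℝ] (FluctIdx F k K → ℝ))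
    (hk : k + 1 ≤ (F.P K).m + (F.P K).K) (hA : RecordB0BlockInvertible F k K Vk) (σ : Fin (Module.finrank ℝ (fluctKer F k K Vk)) ≃ NonB0Idx F k K)
    (hP : (recordPrecLoc F k K εbg U Vk 𝒞 hopLin).PosDef) :
    recordLogZkΔ1Can F k K εbg U Vk 𝒞 hopLin = recordLogZkLoc F k K εbg U Vk 𝒞 hopLin := by
  rw [recordLogZkΔ1Can, recordLogZkLoc, recordZkΔ1Can_eq_recordZkLoc F k K εbg U Vk 𝒞 hopLin hk hA σ hP]

open Classical in
/-- ★★ **THE Z-BRIDGE AT THE NAMES (corrected (2.11) form, representative-free)**: `recordZkkCan … Vk hopLin = recordZkkLoc … Vk hopLin` UNDER the letter, the dimension match and positivity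
of `recordPreckLoc`. [cite: Balaban1987RG1, (1.4) p.260, (2.10)–(2.11) p.267, p.268] -/
theorem recordZkkCan_eq_recordZkkLoc (k K : ℕ) (εbg : ℝ) (Vk : GaugeField (F.P K) k (SU 2))
    (hopLin : (PBond (F.P K) (k + 1) → MatA 2) →ₗ[ℝ] (FluctIdx F k K → ℝ))
    (hk : k + 1 ≤ (F.P K).m + (F.P K).K) (hA : RecordB0BlockInvertible F k K Vk) (σ : Fin (Module.finrank ℝ (fluctKer F k K Vk)) ≃ NonB0Idx F k K)
    (hP : (recordPreckLoc F k K εbg Vk hopLin).PosDef) :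
    recordZkkCan F k K εbg Vk hopLin = recordZkkLoc F k K εbg Vk hopLin := by
  set e : CoarseIdx F k K ⊕ NonB0Idx F k K ≃ FluctIdx F k K := Equiv.ofBijective _ (blkToFluct_bijective F k K hk) with he
  have hecoe : (⇑e : CoarseIdx F k K ⊕ NonB0Idx F k K → FluctIdx F k K) = blkToFluct F k K := rfl
  set S := recordSk₁ F k K εbg Vk hopLin with hS
  set Cop := recordCop F k K Vk with hCop
  set C' : Matrix (CoarseIdx F k K ⊕ NonB0Idx F k K) (NonB0Idx F k K) ℝ := Cop.submatrix (⇑e) (⇑σ.symm) with hC'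
  have hSblk : recordSkBlk F k K εbg Vk hopLin = S.submatrix (⇑e) (⇑e) := by rw [hecoe]; rfl
  have hMblk : recordLQtBlk F k K Vk = (recordLQtMat F k K Vk).submatrix _root_.id (⇑e) := by rw [hecoe]; exact recordLQtBlk_eq_submatrix F k K Vk
  have h0 : recordLQtBlk F k K Vk * C' = 0 := by
    rw [hMblk, hC', Matrix.submatrix_mul_equiv, hCop, recordLQtMat_mul_recordCop]
    rfl
  have hinj : Function.Injective C'.mulVec := by
    intro v w hvw
    rw [hC', Matrix.submatrix_mulVec_equiv, Matrix.submatrix_mulVec_equiv, Equiv.symm_symm] at hvw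
    have h1 : Cop *ᵥ (v ∘ ⇑σ) = Cop *ᵥ (w ∘ ⇑σ) := by
      funext i
      have := congrFun hvw (e.symm i)
      simpa using this
    have h2 := recordCop_mulVec_injective F k K Vk h1
    funext j
    have := congrFun h2 (σ.symm j)
    simpa using this
  have hX := recordLQtB0_mul_recordXLoc F k K Vk hA
  have hbridge := zGram_eq_zLoc (S.submatrix (⇑e) (⇑e)) (recordLQtB0 F k K Vk) (recordLQtOff F k K Vk) (recordXLoc F k K Vk) hA hX C'
    (by rw [← h0]; rfl) hinj (by rw [← hSblk]; exact hP)
  have hC'fac := eq_graphC_mul_toRows₂ (recordLQtB0 F k K Vk) (recordLQtOff F k K Vk) (recordXLoc F k K Vk) hA hX C' (by rw [← h0]; rfl)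
  have hY := isUnit_det_toRows₂ (recordXLoc F k K Vk) C' hC'fac hinj
  have hposC' : (C'ᵀ * S.submatrix (⇑e) (⇑e) * C').PosDef := by
    rw [hC'fac]
    exact posDef_conj_basis _ _ _ (by rw [← hSblk]; exact hP) hY
  have hJac : recordJacQ F k K Vk = Real.sqrt (recordLQtBlk F k K Vk * (recordLQtBlk F k K Vk)ᵀ).det := by
    rw [recordJacQ, hMblk, submatrix_mul_transpose_equiv]
  have hGram : recordGramC F k K Vk = Real.sqrt (C'ᵀ * C').det := by
    rw [recordGramC, hC', ← hCop, show Cop.submatrix (⇑e) (⇑σ.symm) = (Cop.submatrix (⇑e) _root_.id).submatrix _root_.id (⇑σ.symm) from rfl,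
      gram_submatrix_cols, Matrix.det_submatrix_equiv_self, gram_submatrix_equiv]
  have hZ : B12Eq15QuadraticForm.Z14 S Cop = B12Eq15QuadraticForm.Z14 (S.submatrix (⇑e) (⇑e)) C' := by
    rw [← Z14_submatrix_equiv S Cop e]
    have hCb : Cop.submatrix (⇑e) _root_.id = C'.submatrix _root_.id (⇑σ) := by
      rw [hC']
      ext i j
      simp
    rw [hCb, Z14_submatrix_cols _ _ σ hposC']
  rw [recordZkkCan, recordZkkLoc, ← hS, ← hCop, hJac, hGram, hZ, mul_assoc, recordLQtBlk, hbridge, hSblk]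
  rfl

open Classical in
/-- `log` form of the Z-bridge (corrected (2.11) form): `recordLogZkkCan = recordLogZkkLoc`. [cite: Balaban1987RG1, (1.3)–(1.4) p.260, (2.11)–(2.12) p.267] -/
theorem recordLogZkkCan_eq_recordLogZkkLoc (k K : ℕ) (εbg : ℝ) (Vk : GaugeField (F.P K) k (SU 2))
    (hopLin : (PBond (F.P K) (k + 1) → MatA 2) →ₗ[ℝ] (FluctIdx F k K → ℝ))
    (hk : k + 1 ≤ (F.P K).m + (F.P K).K) (hA : RecordB0BlockInvertible F k K Vk) (σ : Fin (Module.finrank ℝ (fluctKer F k K Vk)) ≃ NonB0Idx F k K)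
    (hP : (recordPreckLoc F k K εbg Vk hopLin).PosDef) :
    recordLogZkkCan F k K εbg Vk hopLin = recordLogZkkLoc F k K εbg Vk hopLin := by
  rw [recordLogZkkCan, recordLogZkkLoc, recordZkkCan_eq_recordZkkLoc F k K εbg Vk hopLin hk hA σ hP]

end Summit.QuantumFields.YangMills.Theorems.BalabanUVNodesPortS1

end
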